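import Mathlib
import HarnessLib
import Summits.HubbardSuperconductivity.HubbardSuperconductivity.Theorems.KLProgrammeKLRegimeAlphaWtSectionalFlowDeepVol
import Summits.HubbardSuperconductivity.HubbardSuperconductivity.Theorems.KLProgrammeKLRegimeSectorSliceGramRegime
import Summits.HubbardSuperconductivity.HubbardSuperconductivity.Theorems.KLProgrammeKLRegimeTwoVolumeDataKitWt

/-!
# K3 VL child `KLRegimeVolumeLimitV17F2` (stmt-HubbardSuperconductivity-20440), blueprint v5 M3b-j (i)+(ii) BY NAME: the ONE-VOLUME COVARIANCE DATA BUNDLE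
# `ScaleCovData` of the sector covariance sampled on any lattice `V` at the coarse flow frame `K_n`, deep window

Cell `gate-hubbard-kl`, seat p3 (g12).  `…TwoVolumeModelScaleSucc.model_sum_norm_kernel_twoVolume_scaleSucc_composite_le` (k3c4-p1 g12) reads, for the two step covariances
`CL_V = S_V(F̃_j[K])ᵀ·C^{K}_{(Λ_{j+2},Λ_{j+1}]}(V)·S_V(F̃_j[K])` at a COMMON frame `K` on `V ∈ {L, L″}`, the bundles `hC : ScaleCovData CL Λ κ αW sW`,
`hC' : ScaleCovData CLf Λ κ' αW' sW'` and `hCsec : ScaleCovSecData CLf Λ eW'` (`…TwoVolumeSpineDataDefs`).  The sectional bundle is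
`scaleCovSecData_klSliceCov_bgmFat_klEng_flow_deep_vol` (p3 g12); this file assembles the FULL `ScaleCovData` bundle at the flow frame from three landed doors:

* Gram constant — k3c2-p3's `gram_entry_klSliceCov_bgmFat_klEng` (`IsGramBoundedR C √(Cκ·(Λ_nf/Λ_{nf+j})·klE0·8^{−nf})`; its extra binders `P.WF`,
  `U ≤ klEngU₀4 P R cc`, `klEngM₃ β U V ≤ M` are carried);
* Λ_w-scaled rows / columns — `alphaWt_klSliceCov_bgmFat_klEng_flow_deep_vol` at weight scale `nw := nf + j`, converted from the engine's `klScaleWt` currency by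
  `…TwoVolumeDataKitWt.one_add_mul_tnorm_le_klScaleWt_pair` (`Λ_w ≤ Λ_{nf+j}`): `αW = Cα·(M/β)/Λ_{nf+j}` (the expected `1/ε`);
* ε-FREE entry sup — a single entry is at most the SECTIONAL row through it (`secWt_klSliceCov_bgmFat_klEng_flow_deep_vol`, weights `≥ 1`): `sW := Ce`.

* **`scaleCovData_klSliceCov_bgmFat_klEng_flow_deep_vol (j d)`** — `∃ Cκ Cα Ce > 0`: under the `E4FlowAt` / stub-(b) binders at volume `L` plus `P.WF`,
  `U ≤ klEngU₀4 P R cc`, a lattice `V` with `klEngL₃ β U ≤ V`, `klEngM₃ β U V ≤ M`, `1 ≤ nf`, `nf + j ≤ n_β + 1`, `4^{n+2}·U ≤ 4^{2·nf+d}`, `0 ≤ Λ_w ≤ Λ_{nf+j}`: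
  `ScaleCovData (S_V(F̃_nf)ᵀ·klSliceCov_V (nf+j)·S_V(F̃_nf))[K_n] Λ_w √(Cκ·(Λ_nf/Λ_{nf+j})·klE0·8^{−nf}) (Cα·(M/β)/Λ_{nf+j}) Ce` (M5's `hC`/`hC'` at `V := L`/`L″`,
  `nf := j`, door `j := 2`; `IsGramBoundedR.mono` enlarges `κ` if the caller prefers an `nf`-free one).

Everything is proved; no definitions. [cite: BenfattoGiulianiMastropietro2006, §2.8 (2.81), §3 (3.3)]
-/

noncomputable section

namespace Summit.HubbardSuperconductivity.HubbardSuperconductivity.Theorems.TorusFourierL2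

set_option linter.dupNamespace false -- summit = problem name (single-conjunct summit), D-0017

open Set Finset Literature.MathematicalPhysics.QuantumLattice Literature.MathematicalPhysics.QuantumLattice.BandSectorCounting
open Literature.MathematicalPhysics.QuantumLattice.FermiRG Literature.Probability.LatticeModels Literature.Analysis.SpecialFunctions
open Summit.HubbardSuperconductivity.HubbardSuperconductivity.Theorems.DispersionFlow
open Summit.HubbardSuperconductivity.HubbardSuperconductivity.Theorems.KLRegimeSplit
open Summit.HubbardSuperconductivity.HubbardSuperconductivity.Theorems.KLProgrammeLegKernels
open Summit.HubbardSuperconductivity.HubbardSuperconductivity.Theorems.PerturbedFermiCurve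
open Summit.HubbardSuperconductivity.HubbardSuperconductivity.Theorems.KLRegimeWick
open Summit.HubbardSuperconductivity.HubbardSuperconductivity.Theorems.EngineV8
open scoped Real Nat

open Classical

set_option maxHeartbeats 800000 in -- long binder list
/-- **M3b-j (i) BY NAME: the `ScaleCovData` bundle of `(S_V(F̃_nf)ᵀ·klSliceCov_V (nf+j)·S_V(F̃_nf))[K_n]` on any lattice `V`, deep window, every rate
`0 ≤ Λ_w ≤ Λ_{nf+j}`** — Gram constant (k3c2-p3), Λ_w-scaled rows/columns `≤ Cα·(M/β)/Λ_{nf+j}` (the engine's `α_w`), ε-free entry sup `≤ Ce` (the sectional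
row); see the module docstring. [cite: BenfattoGiulianiMastropietro2006, §2.8 (2.81), §3 (3.3)] -/
theorem scaleCovData_klSliceCov_bgmFat_klEng_flow_deep_vol (j dd : ℕ) :
    ∃ Cκ Cα Ce : ℝ, 0 < Cκ ∧ 0 < Cα ∧ 0 < Ce ∧
      ∀ (G : GeoConsts) (P : SplitConsts) (R : RenConsts) (Q : EngConsts) (cc : ℝ), P.WF → R.WF2 → 0 < cc → cc ≤ EngineV8.klEngC₃6 P R →
      ∀ μ ∈ klWindowC, ∀ U : ℝ, 0 < U → U ≤ min (EngineV8.klEngU₀3 P R cc) (1 / (R.Gfr 3 + 1)) → U ≤ EngineV8.klEngU₀4 P R cc →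
      ∀ β : ℝ, klBetaMin ≤ β → β ≤ Real.exp (cc / U ^ 2) →
      ∀ (L M : ℕ) [NeZero L] [NeZero M], EngineV8.klEngL₃ β U ≤ L → EngineV8.klEngM₃ β U L ≤ M →
      ∀ n : ℕ, 1 ≤ n → n ≤ nScales β + 1 →
        HistP klPredsV17F2 L M G P Q R β U μ 0 n → FrameOK R U (nScales β) μ (klFlowFrameU L M β U μ n) →
        ∀ (V : ℕ) [NeZero V], EngineV8.klEngL₃ β U ≤ V → EngineV8.klEngM₃ β U V ≤ M →
        ∀ nf : ℕ, 1 ≤ nf → nf + j ≤ nScales β + 1 → (4 : ℝ) ^ (n + 2) * U ≤ (4 : ℝ) ^ (2 * nf + dd) →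
        ∀ Λw : ℝ, 0 ≤ Λw → Λw ≤ klScale klE0 (nf + j) →
          TwoVolumeDefect.ScaleCovData
            ((sectorSubMatrix V M β (bgmFatMultiplier V M klE0 β (nambuXiCT V μ (klFlowFrameU L M β U μ n)) nf)).transpose *
              klSliceCov V M β μ (klFlowFrameU L M β U μ n) (nf + j) *
              sectorSubMatrix V M β (bgmFatMultiplier V M klE0 β (nambuXiCT V μ (klFlowFrameU L M β U μ n)) nf)) Λw
            (Real.sqrt (Cκ * (klScale klE0 nf / klScale klE0 (nf + j)) * (klE0 * ((8 : ℝ) ^ nf)⁻¹)))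
            (Cα * ((M : ℝ) / β) / klScale klE0 (nf + j)) Ce := by
  obtain ⟨Cκ, hCκ, hG⟩ := gram_entry_klSliceCov_bgmFat_klEng
  obtain ⟨Cα, hCα, hA⟩ := alphaWt_klSliceCov_bgmFat_klEng_flow_deep_vol j dd
  obtain ⟨Ce, hCe, hS⟩ := secWt_klSliceCov_bgmFat_klEng_flow_deep_vol j dd
  refine ⟨Cκ, Cα, Ce, hCκ, hCα, hCe, ?_⟩
  intro G P R Q cc hP hR2 hcc hcc6 μ hμ U hU hUle hU4 β hβmin hβc L M _ _ hL3 hM3 n hn1 hnN hhist hfr V _ hV3 hVM3 nf hnf hnfN hwin Λw hΛw0 hΛwle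
  have hβ0 : 0 < β := pos_of_klBetaMin_le hβmin
  have hcc3 : cc ≤ EngineV8.klEngC₃3 P R := hcc6.trans (EngineV8.klEngC₃6_le_klEngC₃3 P R)
  have hMβ : β ≤ (M : ℝ) := EngineV8.le_of_klEngM₃_le hβmin hL3 hM3
  -- the three doors
  obtain ⟨-, hgram⟩ := hG P R cc hP hR2 hcc hcc3 μ hμ U hU hU4 β hβmin hβc (klFlowFrameU L M β U μ n) hfr V M hV3 hVM3 nf hnf (by omega)
    (nf + j) (by omega)
  obtain ⟨hrow, hcol⟩ := hA G P R Q cc hR2 hcc hcc6 μ hμ U hU hUle β hβmin hβc L M hL3 hM3 n hn1 hnN hhist hfr V hV3 nf hnf hnfN hwin (nf + j) le_rfl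
  have hsec := hS G P R Q cc hR2 hcc hcc6 μ hμ U hU hUle β hβmin hβc L M hL3 hM3 n hn1 hnN hhist hfr V hV3 nf hnf hnfN hwin Λw hΛw0 hΛwle
  set C : Matrix (SpaceTimeIdx V M × SectorLeg (sectorCount nf)) (SpaceTimeIdx V M × SectorLeg (sectorCount nf)) ℂ :=
    (sectorSubMatrix V M β (bgmFatMultiplier V M klE0 β (nambuXiCT V μ (klFlowFrameU L M β U μ n)) nf)).transpose *
      klSliceCov V M β μ (klFlowFrameU L M β U μ n) (nf + j) *
      sectorSubMatrix V M β (bgmFatMultiplier V M klE0 β (nambuXiCT V μ (klFlowFrameU L M β U μ n)) nf) with hCdef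
  -- positivity of the constants
  have he0 : (0 : ℝ) < klE0 := by norm_num [klE0]
  have hΛnf := klth_klScale_pos nf
  have hΛs := klth_klScale_pos (nf + j)
  have hM0 : (0 : ℝ) < M := lt_of_lt_of_le hβ0 hMβ
  have hκpos : 0 < Real.sqrt (Cκ * (klScale klE0 nf / klScale klE0 (nf + j)) * (klE0 * ((8 : ℝ) ^ nf)⁻¹)) := Real.sqrt_pos.2 (by positivity)
  have hαpos : 0 < Cα * ((M : ℝ) / β) / klScale klE0 (nf + j) := by positivity
  -- the weight domination `1 + Λ_w·tnorm ≤ klScaleWt (nf+j)` (`Λ_w ≤ Λ_{nf+j}`)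
  have hdom : ∀ X Y : SpaceTimeIdx V M × SectorLeg (sectorCount nf), 1 + Λw * (Torus.tnorm (X.1.2 - Y.1.2) : ℝ) ≤
      EngineV8.klScaleWt V M β (nf + j) {EngineV8.latticeLegPos (2 * (2 * M)) X, EngineV8.latticeLegPos (2 * (2 * M)) Y} :=
    fun X Y => TwoVolumeDefect.one_add_mul_tnorm_le_klScaleWt_pair hβ0.le hΛwle X Y
  refine ⟨hκpos, hgram, hαpos, fun X => ?_, fun Y => ?_, hCe.le, fun X Y => ?_⟩
  · exact TwoVolumeDefect.sum_mul_le_of_sum_mul_le_of_le _ _ _ _ (fun Y _ => norm_nonneg _) (fun Y _ => hdom X Y) (hrow X)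
  · exact TwoVolumeDefect.sum_mul_le_of_sum_mul_le_of_le _ _ _ _ (fun X _ => norm_nonneg _) (fun X _ => hdom X Y) (hcol Y)
  · -- a single entry is at most the sectional row through it (weights `≥ 1`)
    have ht : (0 : ℝ) ≤ Torus.tnorm (X.1.2 - Y.1.2) := Nat.cast_nonneg _
    calc ‖C X Y‖ ≤ ‖C X Y‖ * (1 + Λw * (Torus.tnorm (X.1.2 - Y.1.2) : ℝ)) :=
          le_mul_of_one_le_right (norm_nonneg _) (le_add_of_nonneg_right (mul_nonneg hΛw0 ht))
      _ ≤ ∑ y : TorusSite 2 V, ‖C X ((Y.1.1, y), Y.2)‖ * (1 + Λw * (Torus.tnorm (X.1.2 - y) : ℝ)) :=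
          Finset.single_le_sum (f := fun y : TorusSite 2 V => ‖C X ((Y.1.1, y), Y.2)‖ * (1 + Λw * (Torus.tnorm (X.1.2 - y) : ℝ)))
            (fun y _ => by positivity) (Finset.mem_univ Y.1.2)
      _ ≤ Ce := hsec X Y.1.1 Y.2

end Summit.HubbardSuperconductivity.HubbardSuperconductivity.Theorems.TorusFourierL2

end
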